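import Summits.QuantumFields.YangMills.Theorems.ParabolicTrajectoryTunedSequenceExistsMirrorBound

/-!
# `TunedSequenceExists` (stmt-QuantumFields-10524), line `fixed-aspect-window`:
# both MIRROR correlators of the corner density are non-negative (every odd torus, `β ≥ 0`)

By-product of the worker on stub `stub_mirrorBoundOut` (seat c4, `--supports`).  `P = r.curvature.F`
is Wilson's corner action density (links in the slices `x⁰ ∈ {0, 1}`), `Pᴿ := P ∘ cfgReflect` its
time mirror.  `MirrorBound.sq_corr_le_mirror_*` record the signs of the two RP-diagonal mirror
correlators only at the Cauchy–Schwarz lags; here the one reflection-positivity call behind them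
(`cov_theta_nonneg`: `0 ≤ Cov(F ∘ Θ_p, F)` for a translate `F` of a local observable inside the
positive half of the link hyperplane `t = p + ½` of the torus `2S+1`) is run over its full range
(`cov_inward_odd_nonneg`, `cov_outward_odd_nonneg`), and even lags are folded periodically
(`cov_fold`: on the odd torus the site reflection through `t = m` IS the link reflection through
`t = m + S + ½`): **`inwardMirror_nonneg`** `0 ≤ ⟨P ; τ_D Pᴿ⟩_{β,2L+1}` for `4 ≤ D ≤ L`, and
**`outwardMirror_nonneg`** `0 ≤ ⟨Pᴿ ; τ_D P⟩_{β,2L+1}` for `3 ≤ D ≤ L`.  So the stubs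
`stub_mirrorBoundIn/Out` are one-sided ceilings on NON-NEGATIVE quantities (positive spectral
weight of one vector).  References: Osterwalder–Seiler 1978 §2; Seiler LNP 159 Ch. 2.
-/

noncomputable section

open MeasureTheory ProbabilityTheory Finset
open Literature.MathematicalPhysics.QuantumFieldTheory hiding Site ZdEdge
open Literature.MathematicalPhysics.QuantumLattice
open Literature.Probability.LatticeModels hiding configShift configShift_apply
open Summit.QuantumFields.YangMills.Theorems.FiniteSusceptibilityWeakCoupling
open Summit.QuantumFields.YangMills.Theorems.FiniteSusceptibilityWeakCoupling.MirrorDominationAxis0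

namespace Summit.QuantumFields.YangMills.Theorems.TunedSequenceExists.MirrorPositivity

variable {G : Type} [Group G] [TopologicalSpace G] [IsTopologicalGroup G] [CompactSpace G]
  [MeasurableSpace G] [BorelSpace G]

/-- Links read by the corner density have time coordinate in `[-1, 1]`. [folklore] -/
theorem time_mem_of_mem_curvature_supp (r : LatticeRep G) {e : ZdEdge 4}
    (he : e ∈ r.curvature.supp) : (-1 : ℤ) ≤ e.1 0 ∧ e.1 0 ≤ 1 := by
  have := MirrorBound.natAbs_le_one_of_mem_curvature_supp r he; omega

/-- Links read by the mirror corner density `Pᴿ` have time coordinate in `[-2, 1]`. [folklore] -/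
theorem time_mem_of_mem_reflSpecies_supp (r : LatticeRep G) {e : ZdEdge 4}
    (he : e ∈ (reflSpecies r.curvature).supp) : (-2 : ℤ) ≤ e.1 0 ∧ e.1 0 ≤ 1 := by
  obtain ⟨e', he', rfl⟩ := Finset.mem_image.1 he
  have ht := MirrorBound.natAbs_le_one_of_mem_curvature_supp r he'
  rw [reflectEdge_fst_zero]
  split_ifs <;> omega

/-- **One reflection-positivity call.** If every link read by the local observable `B` has time
coordinate in `[a, b]` and `p + 1 ≤ c + a`, `c + b ≤ p + S`, then the translate `F = B ∘ τ_c ∘ lift` lives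
in the positive half of the link hyperplane `t = p + ½` of the torus `2S+1`, and `0 ≤ Cov(F ∘ Θ_p, F)`
for `β ≥ 0` (`Θ_p` lifted `= Θ ∘ τ_{2p+1}`, `torusLift_theta`). [cite: OsterwalderSeiler1978, §2] -/
theorem cov_theta_nonneg (r : LatticeRep G) {β : ℝ} (hβ : 0 ≤ β) (B : YMSpecies G) {a b : ℤ}
    (hB : ∀ e ∈ B.supp, a ≤ e.1 0 ∧ e.1 0 ≤ b) {S p : ℕ} {c : ℤ} (h1 : (p : ℤ) + 1 ≤ c + a)
    (h2 : c + b ≤ p + S) (hS : 1 ≤ S) :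
    0 ≤ cov[fun U => B.F (configShift (-(Pi.single 0 c))
          (cfgReflect (configShift (-(Pi.single 0 ((2 * p + 1 : ℕ) : ℤ))) (torusLift (2 * S + 1) U)))),
        fun U => B.F (configShift (-(Pi.single 0 c)) (torusLift (2 * S + 1) U));
        wilsonMeasure (d := 4) (L := 2 * S + 1) r.ρ β] := by
  -- adapted from `MirrorBound.sq_cov_le_mirror` (one diagonal term, `F = G'`)
  haveI : IsProbabilityMeasure (wilsonMeasure (d := 4) (L := 2 * S + 1) r.ρ β) :=
    isProbabilityMeasure_wilsonMeasure _ r.continuous β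
  have hm : Measurable fun U : GaugeConfig 4 (2 * S + 1) G =>
      B.F (configShift (-(Pi.single 0 c)) (torusLift (2 * S + 1) U)) :=
    B.measurable.comp ((configShift _).measurable.comp (measurable_torusLift _))
  have key := fun hd => (stub_rpCauchySchwarz stub_oddTorusRP G r.N r.ρ r.continuous β hβ S hS 1
    (Torus.proj (2 * S + 1) (Pi.single 0 (p : ℤ))) _ _ hm hm
    (by obtain ⟨C, hC⟩ := B.bounded; exact ⟨C, fun U => hC _⟩)
    (by obtain ⟨C, hC⟩ := B.bounded; exact ⟨C, fun U => hC _⟩) hd hd).1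
  have hD := key (by
    refine (Negative.dependsOn_comp_configShift_torusLift (2 * S + 1) B _).mono ?_
    intro e he
    obtain ⟨e', he', rfl⟩ := Finset.mem_image.1 (Finset.mem_coe.1 he)
    have ht := hB e' he'
    have h0 : (e'.1 + (Pi.single 0 c : Site 4)) 0 = e'.1 0 + c := by rw [Pi.add_apply, Pi.single_eq_same]
    refine torusEdge_mem_pos S p _ _ ?_ ?_ <;> rw [h0] <;> omega)
  simpa only [torusLift_theta] using hD

/-- **Inward odd lags.** For `β ≥ 0`, `2 ≤ p ≤ S - 2`: `0 ≤ Cov(P ∘ lift, Pᴿ ∘ τ_{2p+1} ∘ lift)` on the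
torus `2S+1` (`F = Pᴿ ∘ τ_{2p+1} ∘ lift`, `F ∘ Θ_p = P ∘ lift`). [cite: OsterwalderSeiler1978, §2] -/
theorem cov_inward_odd_nonneg (r : LatticeRep G) {β : ℝ} (hβ : 0 ≤ β) {S p : ℕ} (h2 : 2 ≤ p)
    (hpS : p + 2 ≤ S) :
    0 ≤ cov[fun U => r.curvature.F (torusLift (2 * S + 1) U),
        fun U => (reflSpecies r.curvature).F
          (configShift (-(Pi.single 0 ((2 * p + 1 : ℕ) : ℤ))) (torusLift (2 * S + 1) U));
        wilsonMeasure (d := 4) (L := 2 * S + 1) r.ρ β] := by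
  have h := cov_theta_nonneg r hβ (reflSpecies r.curvature)
    (fun e he => time_mem_of_mem_reflSpecies_supp r he) (S := S) (p := p)
    (c := ((2 * p + 1 : ℕ) : ℤ)) (by push_cast; omega) (by push_cast; omega) (by omega)
  simpa only [reflSpecies_F_shift_cfgReflect_shift] using h

/-- **Outward odd lags.** For `β ≥ 0`, `p + 2 ≤ n`, `n + 1 ≤ p + S`: `0 ≤ Cov(Pᴿ ∘ lift, P ∘ τ_{2n-2p-1} ∘ lift)`
on the torus `2S+1` (`G' = P ∘ τ_n ∘ lift`, `G' ∘ Θ_p = Pᴿ ∘ τ_{2p+1-n} ∘ lift`, then translate). [cite: OsterwalderSeiler1978, §2] -/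
theorem cov_outward_odd_nonneg (r : LatticeRep G) {β : ℝ} (hβ : 0 ≤ β) {S p n : ℕ} (h1 : p + 2 ≤ n)
    (h2 : n + 1 ≤ p + S) :
    0 ≤ cov[fun U => (reflSpecies r.curvature).F (torusLift (2 * S + 1) U),
        fun U => r.curvature.F
          (configShift (-(Pi.single 0 ((2 * n - 2 * p - 1 : ℕ) : ℤ))) (torusLift (2 * S + 1) U));
        wilsonMeasure (d := 4) (L := 2 * S + 1) r.ρ β] := by
  have h := cov_theta_nonneg r hβ r.curvature (fun e he => time_mem_of_mem_curvature_supp r he)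
    (S := S) (p := p) (c := (n : ℤ)) (by omega) (by omega) (by omega)
  simp only [F_shift_cfgReflect_shift] at h
  have hvec : -(Pi.single 0 (n : ℤ) : Site 4) +
      (siteReflect (Pi.single 0 (n : ℤ)) + Pi.single 0 ((2 * p + 1 : ℕ) : ℤ)) =
      -(Pi.single 0 ((2 * n - 2 * p - 1 : ℕ) : ℤ)) := by
    funext k; by_cases hk : k = 0 <;> simp [siteReflect_apply, hk]
    omega
  rwa [cov_translate_left r.ρ β (reflSpecies r.curvature).F r.curvature.F hvec] at h

/-- **The inward mirror correlator is non-negative** at every separation `4 ≤ D ≤ L`, `β ≥ 0`: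
`0 ≤ ⟨P ; τ_D Pᴿ⟩_{β,2L+1}` (odd `D` directly; even `D` as the periodic fold of the outward odd lag `2L+1-D`). [cite: OsterwalderSeiler1978, §2] -/
theorem inwardMirror_nonneg (r : LatticeRep G) {β : ℝ} (hβ : 0 ≤ β) {L D : ℕ} (h4 : 4 ≤ D)
    (hD : D ≤ L) :
    0 ≤ latticeConnectedCorr r.ρ β (2 * L + 1) r.curvature.F
        (fun V => r.curvature.F (cfgReflect V)) D := by
  rcases Nat.even_or_odd D with ⟨m, rfl⟩ | ⟨q, rfl⟩
  · -- even `D = 2m`, `m ≥ 2`: outward odd lag `2L+1-2m` (`p = 0`, `n = L+1-m`), folded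
    have h := cov_outward_odd_nonneg r hβ (S := L) (p := 0) (n := L + 1 - m) (by omega) (by omega)
    have hj : 2 * (L + 1 - m) - 2 * 0 - 1 = 2 * L + 1 - (m + m) := by omega
    rw [hj, cov_fold r.ρ β (reflSpecies r.curvature).F r.curvature.F
      (show 2 * L + 1 - (m + m) ≤ 2 * L + 1 by omega)] at h
    have hS : 2 * L + 1 - (2 * L + 1 - (m + m)) = m + m := by omega
    rw [hS, SiblingFunnel.covariance_eq_latticeConnectedCorr] at h
    exact h
  · -- odd `D = 2q+1`, `q ≥ 2`: `p = q`
    have h := cov_inward_odd_nonneg r hβ (S := L) (p := q) (by omega) (by omega)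
    rw [SiblingFunnel.covariance_eq_latticeConnectedCorr] at h
    exact h

/-- **The outward mirror correlator is non-negative** at every separation `3 ≤ D ≤ L`, `β ≥ 0`:
`0 ≤ ⟨Pᴿ ; τ_D P⟩_{β,2L+1}` (odd `D` directly, `p = 0`; even `D = 2m` as the periodic fold of the inward odd lag `2(L-m)+1`). [cite: OsterwalderSeiler1978, §2] -/
theorem outwardMirror_nonneg (r : LatticeRep G) {β : ℝ} (hβ : 0 ≤ β) {L D : ℕ} (h3 : 3 ≤ D)
    (hD : D ≤ L) :
    0 ≤ latticeConnectedCorr r.ρ β (2 * L + 1) (fun V => r.curvature.F (cfgReflect V))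
        r.curvature.F D := by
  rcases Nat.even_or_odd D with ⟨m, rfl⟩ | ⟨q, rfl⟩
  · -- even `D = 2m`, `m ≥ 2`: inward odd lag `2(L-m)+1`, folded
    have h := cov_inward_odd_nonneg r hβ (S := L) (p := L - m) (by omega) (by omega)
    rw [cov_fold r.ρ β r.curvature.F (reflSpecies r.curvature).F
      (show 2 * (L - m) + 1 ≤ 2 * L + 1 by omega)] at h
    have hS : 2 * L + 1 - (2 * (L - m) + 1) = m + m := by omega
    rw [hS, SiblingFunnel.covariance_eq_latticeConnectedCorr] at h
    exact h
  · -- odd `D = 2q+1`, `q ≥ 1`: `p = 0`, `n = q + 1`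
    have h := cov_outward_odd_nonneg r hβ (S := L) (p := 0) (n := q + 1) (by omega) (by omega)
    have hq : 2 * (q + 1) - 2 * 0 - 1 = 2 * q + 1 := by omega
    rw [hq, SiblingFunnel.covariance_eq_latticeConnectedCorr] at h
    exact h

end Summit.QuantumFields.YangMills.Theorems.TunedSequenceExists.MirrorPositivity
end
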